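import Mathlib
import Summits.Ventures.LatticeQCDFlow.Scaling.GroupSlabCost
import Summits.Ventures.LatticeQCDFlow.Scaling.GroupPlaquetteLayer

/-!
# LatticeQCDFlow / Scaling — THE EIGENVALUE for a general compact gauge group: the plaquette
# observable is an eigenfunction of the centred order-four kernel with eigenvalue `θ⁴`

HONEST FRAMING: exact (Metropolis-corrected) sampling algorithms for lattice gauge theory;
figures of merit are autocorrelation/cost numbers at stated couplings and volumes; no
continuum-physics claim.

Venture `LatticeQCDFlow` (cell pub-lqcd), topic `Scaling`, FANOUT row 30 (lean-1) — OUR WORK, file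
6 of the extension of the slab-chain proof of (LC)/(U′) to a general compact gauge group `G` with a
matrix representation `ρ` carrying one-link data `OneLink ρ θ`.  For `U(1)` the eigenvalue `1/16`
was obtained by counting closed words (`Scaling/U1SlabEigen.lean`); here, for any `G`:
* `unplaqG`, `holG_unplaqG`, **`xObsG_eq_trRe_tubeWord`** — under the bond substitution of
  `Scaling/GroupSlabCost.lean` (`e ↦ (ℓ ↦ plaqG e v e' ℓ)`, inverse `unplaqG`) the lower plaquette
  holonomy becomes the TUBE WORD `u₀ e'₀ u₁ e'₁ e'₂⁻¹ u₂⁻¹ e'₃⁻¹ u₃⁻¹` conjugated by the vertical bond at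
  the origin, so `xObsG(e) = Re tr ρ(tubeWord (plaqG e v e' ·) e')` — the vertical bonds DROP OUT;
* `integral_xObsG_mul_slabCostG_pow_four` — hence `∫∫ xObsG(e) slabCostG(e,v,e')⁴ dv de =
  Σ_{w : Fin 4 → LEdge} ∫ Re tr ρ(tubeWord u e') ∏_k Re tr ρ(u (w k)) du`;
* `integral_tubeWord_word_eq_zero` — a word missing one edge of the plaquette contributes `0`
  (average that bond); `exists_perm_of_hits` — a word hitting all four edges is `pedge ∘ σ` for a
  permutation `σ`, contributing the tube integral `θ⁴ xObsG(e')`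
  (`GroupLayer.integral_trRe_tube`), and there are `4! = 24` of them;
* **`integral_xObsG_mul_rho4G`** — `∫ xObsG(e) ρ₄(e, e') de = θ⁴ · xObsG(e')`: THE EIGENVALUE
  RELATION required by `SlabChain.integral_chain_eigen_const` (`Scaling/SlabChainEigen.lean`), for
  every compact `G` [cite: MontvayMunster1994, §3.6.2 (3.437)].
Elementary; nothing is cited as a fact; `def` `unplaqG`; no `sorry`.
-/

noncomputable section

open MeasureTheory Filter Finset
open Literature.MathematicalPhysics.QuantumFieldTheory
open Summit.Ventures.LatticeQCDFlow.Theory2.Lattice.U1Layer (LSite LEdge zsite usite pedge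
  pedge_injective)

namespace Summit.Ventures.LatticeQCDFlow.Theory2.GroupLayer

variable {G : Type*} [Group G] [TopologicalSpace G] [IsTopologicalGroup G] [CompactSpace G]
  [MeasurableSpace G] [BorelSpace G]
variable {d L : ℕ} [NeZero L] {a i j : Fin d} {N : ℕ} {ρ : G →* Matrix (Fin N) (Fin N) ℂ} {θ : ℝ}
  (hi : i ≠ a) (hj : j ≠ a)

/-! ## 1. The plaquette edges: sources and targets -/

omit [NeZero L] in
/-- `src ℓ₀ = 0`. [folklore] -/
theorem pedge_src_zero : (pedge (L := L) hi hj 0).src = zsite d L a := rfl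

omit [NeZero L] in
/-- `src ℓ₃ = 0`. [folklore] -/
theorem pedge_src_three : (pedge (L := L) hi hj 3).src = zsite d L a := rfl

omit [NeZero L] in
/-- `src ℓ₁ = e_i`. [folklore] -/
theorem pedge_src_one : (pedge (L := L) hi hj 1).src = usite hi := rfl

omit [NeZero L] in
/-- `src ℓ₂ = e_j`. [folklore] -/
theorem pedge_src_two : (pedge (L := L) hi hj 2).src = usite hj := rfl

omit [NeZero L] in
/-- `tgt ℓ₀ = e_i`. [folklore] -/
theorem pedge_tgt_zero : (pedge (L := L) hi hj 0).tgt = usite hi := by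
  apply Subtype.ext; simp [LEdge.tgt, pedge, zsite, usite, Site.shift]

omit [NeZero L] in
/-- `tgt ℓ₃ = e_j`. [folklore] -/
theorem pedge_tgt_three : (pedge (L := L) hi hj 3).tgt = usite hj := by
  apply Subtype.ext; simp [LEdge.tgt, pedge, zsite, usite, Site.shift]

omit [NeZero L] in
/-- `tgt ℓ₁ = e_i + e_j = tgt ℓ₂`. [folklore] -/
theorem pedge_tgt_one : (pedge (L := L) hi hj 1).tgt = (pedge hi hj 2).tgt := by
  apply Subtype.ext; simp [LEdge.tgt, pedge, usite, Site.shift, add_comm]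

/-! ## 2. The plaquette under the bond substitution -/

omit [TopologicalSpace G] [IsTopologicalGroup G] [CompactSpace G] [MeasurableSpace G] [BorelSpace G]
  [NeZero L] in
/-- The inverse bond substitution: `unplaqG v e' u ℓ = v(src ℓ)⁻¹ · u(ℓ) · e'(ℓ) · v(tgt ℓ)`. [folklore] -/
def unplaqG (v : LSite d L a → G) (e' : LEdge d L a → G) (u : LEdge d L a → G) : LEdge d L a → G :=
  fun ℓ => (v ℓ.src)⁻¹ * u ℓ * e' ℓ * v ℓ.tgt

omit [TopologicalSpace G] [IsTopologicalGroup G] [CompactSpace G] [MeasurableSpace G] [BorelSpace G]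
  [NeZero L] in
/-- `unplaqG` undoes the bond substitution. [folklore] -/
theorem unplaqG_plaqG (e : LEdge d L a → G) (v : LSite d L a → G) (e' : LEdge d L a → G) :
    unplaqG v e' (fun ℓ => plaqG e v e' ℓ) = e := by
  funext ℓ
  simp [unplaqG, plaqG, mul_assoc]

omit [TopologicalSpace G] [IsTopologicalGroup G] [CompactSpace G] [MeasurableSpace G] [BorelSpace G]
  [NeZero L] in
/-- **The lower plaquette after the bond substitution is the conjugated tube word**:
`holG (unplaqG v e' u) = v(0)⁻¹ · tubeWord u e' · v(0)`. [folklore] -/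
theorem holG_unplaqG (v : LSite d L a → G) (e' u : LEdge d L a → G) :
    holG hi hj (unplaqG v e' u) = (v (zsite d L a))⁻¹ * tubeWord hi hj u e' * v (zsite d L a) := by
  simp only [holG, unplaqG, tubeWord, pedge_src_zero, pedge_src_three, pedge_src_one, pedge_src_two,
    pedge_tgt_zero, pedge_tgt_three, pedge_tgt_one, mul_inv_rev, inv_inv, mul_assoc,
    mul_inv_cancel_left]

omit [TopologicalSpace G] [IsTopologicalGroup G] [CompactSpace G] [MeasurableSpace G] [BorelSpace G]
  [NeZero L] in
/-- **The plaquette observable through the substitution**: `xObsG(e) = Re tr ρ(tubeWord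
(plaqG e v e' ·) e')` — the vertical bonds drop out. [folklore] -/
theorem xObsG_eq_trRe_tubeWord (ρ : G →* Matrix (Fin N) (Fin N) ℂ) (e : LEdge d L a → G)
    (v : LSite d L a → G) (e' : LEdge d L a → G) :
    xObsG ρ hi hj e = trRe ρ (tubeWord hi hj (fun ℓ => plaqG e v e' ℓ) e') := by
  conv_lhs => rw [← unplaqG_plaqG e v e']
  rw [xObsG, holG_unplaqG, trRe_comm, ← mul_assoc, mul_inv_cancel, one_mul]

/-! ## 3. Words of four free bonds against the tube word -/

section Words

variable [SecondCountableTopology G] (hij : i ≠ j)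
include hij

/-- **A word missing the plaquette bond `pedge k` contributes zero against the tube word.**
[folklore] -/
theorem integral_tubeWord_word_eq_zero (h : OneLink ρ θ) (hL : 2 ≤ L) (e' : LEdge d L a → G)
    {m : ℕ} (w : Fin m → LEdge d L a) (k : Fin 4) (hk : ∀ l, w l ≠ pedge hi hj k) :
    ∫ u, (trRe ρ (tubeWord hi hj u e') : ℂ) * ∏ l, (trRe ρ (u (w l)) : ℂ)
      ∂(Measure.pi fun _ : LEdge d L a => haarProbability G) = 0 := by
  have hc : Continuous fun u : LEdge d L a → G =>
      (trRe ρ (tubeWord hi hj u e') : ℂ) * ∏ l, (trRe ρ (u (w l)) : ℂ) := by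
    refine (Complex.continuous_ofReal.comp ((continuous_trRe ρ h.cont).comp
      ((continuous_tubeWord hi hj).comp (continuous_id.prodMk continuous_const)))).mul ?_
    exact continuous_finsetProd _ fun l _ =>
      Complex.continuous_ofReal.comp ((continuous_trRe ρ h.cont).comp (continuous_apply _))
  obtain ⟨M, hM⟩ := exists_norm_le_of_continuous hc
  refine integral_pi_eq_of_average_eq (pedge hi hj k) hc.measurable hM fun u => ?_
  have hw : ∀ (g : G) (l : Fin m),
      ((Pi.mulSingle (pedge hi hj k) g : LEdge d L a → G) * u) (w l) = u (w l) :=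
    fun g l => mulSingle_mul_apply_ne (hk l) g u
  simp_rw [hw]
  rw [integral_mul_const]
  have h0 : ∫ g, (trRe ρ (tubeWord hi hj ((Pi.mulSingle (pedge hi hj k) g : LEdge d L a → G) * u) e')
      : ℂ) ∂haarProbability G = 0 := by
    -- the inserted letter is either `g` or `g⁻¹`, between words not depending on `g`
    have hne : ∀ (g : G) (k l : Fin 4), l ≠ k →
        ((Pi.mulSingle (pedge hi hj k) g : LEdge d L a → G) * u) (pedge hi hj l) = u (pedge hi hj l) :=
      fun g k l hkl => pedge_mulSingle_ne hi hj hij hL hkl g u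
    fin_cases k
    · have hf : ∀ g : G, tubeWord hi hj ((Pi.mulSingle (pedge hi hj 0) g : LEdge d L a → G) * u) e' =
          1 * g * tubeWord hi hj u e' := fun g => by
        simp only [tubeWord, mulSingle_mul_apply_same, hne g 0 1 (by decide), hne g 0 2 (by decide),
          hne g 0 3 (by decide), one_mul, mul_assoc]
      simp_rw [show (0 : Fin 4) = ⟨0, by omega⟩ from rfl] at hf
      simp_rw [hf]
      exact integral_trRe_mul h _ _
    · have hf : ∀ g : G, tubeWord hi hj ((Pi.mulSingle (pedge hi hj 1) g : LEdge d L a → G) * u) e' =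
          (u (pedge hi hj 0) * e' (pedge hi hj 0)) * g * (u (pedge hi hj 1) * e' (pedge hi hj 1) *
            (e' (pedge hi hj 2))⁻¹ * (u (pedge hi hj 2))⁻¹ * (e' (pedge hi hj 3))⁻¹ * (u (pedge hi hj 3))⁻¹) :=
          fun g => by
        simp only [tubeWord, mulSingle_mul_apply_same, hne g 1 0 (by decide), hne g 1 2 (by decide),
          hne g 1 3 (by decide), mul_assoc]
      simp_rw [show (1 : Fin 4) = ⟨1, by omega⟩ from rfl] at hf
      simp_rw [hf]
      exact integral_trRe_mul h _ _
    · have hf : ∀ g : G, tubeWord hi hj ((Pi.mulSingle (pedge hi hj 2) g : LEdge d L a → G) * u) e' =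
          (u (pedge hi hj 0) * e' (pedge hi hj 0) * u (pedge hi hj 1) * e' (pedge hi hj 1) *
            (e' (pedge hi hj 2))⁻¹ * (u (pedge hi hj 2))⁻¹) * g⁻¹ *
            ((e' (pedge hi hj 3))⁻¹ * (u (pedge hi hj 3))⁻¹) := fun g => by
        simp only [tubeWord, mulSingle_mul_apply_same, hne g 2 0 (by decide), hne g 2 1 (by decide),
          hne g 2 3 (by decide), mul_inv_rev, mul_assoc]
      simp_rw [show (2 : Fin 4) = ⟨2, by omega⟩ from rfl] at hf
      simp_rw [hf]
      exact integral_trRe_mul_inv h _ _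
    · have hf : ∀ g : G, tubeWord hi hj ((Pi.mulSingle (pedge hi hj 3) g : LEdge d L a → G) * u) e' =
          tubeWord hi hj u e' * g⁻¹ * 1 := fun g => by
        simp only [tubeWord, mulSingle_mul_apply_same, hne g 3 0 (by decide), hne g 3 1 (by decide),
          hne g 3 2 (by decide), mul_inv_rev, mul_one, mul_assoc]
      simp_rw [show (3 : Fin 4) = ⟨3, by omega⟩ from rfl] at hf
      simp_rw [hf]
      exact integral_trRe_mul_inv h _ _
  rw [h0, zero_mul]

omit [Group G] [TopologicalSpace G] [IsTopologicalGroup G] [CompactSpace G] [MeasurableSpace G]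
  [BorelSpace G] [SecondCountableTopology G] in
/-- **A word of four letters hitting all four plaquette bonds is a permutation of them.** [folklore] -/
theorem exists_perm_of_hits (hL : 2 ≤ L) (w : Fin 4 → LEdge d L a)
    (hw : ∀ k : Fin 4, ∃ l, w l = pedge hi hj k) :
    ∃ σ : Equiv.Perm (Fin 4), w = pedge hi hj ∘ (σ : Fin 4 → Fin 4) := by
  choose κ hκ using hw
  have hinj : Function.Injective κ := fun k k' hkk' =>
    pedge_injective hi hj hij hL ((hκ k).symm.trans (hkk' ▸ hκ k'))
  have hbij : Function.Bijective κ := Finite.injective_iff_bijective.1 hinj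
  refine ⟨(Equiv.ofBijective κ hbij).symm, funext fun l => ?_⟩
  have hl : κ ((Equiv.ofBijective κ hbij).symm l) = l := Equiv.ofBijective_apply_symm_apply κ hbij l
  rw [Function.comp_apply, ← hκ, hl]

/-- **The value of a word against the tube word**: `θ⁴ xObsG(e')` if it hits all four plaquette
bonds, `0` otherwise. [folklore] -/
theorem integral_tubeWord_word (h : OneLink ρ θ) (hL : 2 ≤ L) (e' : LEdge d L a → G)
    (w : Fin 4 → LEdge d L a) :
    ∫ u, (trRe ρ (tubeWord hi hj u e') : ℂ) * ∏ l, (trRe ρ (u (w l)) : ℂ)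
        ∂(Measure.pi fun _ : LEdge d L a => haarProbability G) =
      if w ∈ (univ : Finset (Equiv.Perm (Fin 4))).image (fun σ : Equiv.Perm (Fin 4) => pedge hi hj ∘ (σ : Fin 4 → Fin 4))
        then (θ : ℂ) ^ 4 * xObsG ρ hi hj e' else 0 := by
  split_ifs with hw
  · obtain ⟨σ, _, rfl⟩ := Finset.mem_image.1 hw
    have hprod : ∀ u : LEdge d L a → G, ∏ l, (trRe ρ (u ((pedge hi hj ∘ (σ : Fin 4 → Fin 4)) l)) : ℂ) =
        ∏ k : Fin 4, (trRe ρ (u (pedge hi hj k)) : ℂ) := fun u =>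
      Equiv.prod_comp σ (fun k => (trRe ρ (u (pedge hi hj k)) : ℂ))
    simp_rw [hprod]
    exact integral_trRe_tube hi hj hij h hL e'
  · -- some plaquette bond is missed
    have hmiss : ∃ k : Fin 4, ∀ l, w l ≠ pedge hi hj k := by
      by_contra hc
      apply hw
      have hall : ∀ k : Fin 4, ∃ l, w l = pedge hi hj k := fun k => by
        by_contra hk
        exact hc ⟨k, fun l hl => hk ⟨l, hl⟩⟩
      obtain ⟨σ, rfl⟩ := exists_perm_of_hits hi hj hij hL w hall
      exact Finset.mem_image.2 ⟨σ, mem_univ _, rfl⟩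
    obtain ⟨k, hk⟩ := hmiss
    exact integral_tubeWord_word_eq_zero hi hj hij h hL e' w k hk

omit [Group G] [TopologicalSpace G] [IsTopologicalGroup G] [CompactSpace G] [MeasurableSpace G]
  [BorelSpace G] [SecondCountableTopology G] in
/-- There are `4! = 24` words hitting all four plaquette bonds. [folklore] -/
theorem card_perm_words (hL : 2 ≤ L) :
    ((univ : Finset (Equiv.Perm (Fin 4))).image
      (fun σ : Equiv.Perm (Fin 4) => pedge (L := L) hi hj ∘ (σ : Fin 4 → Fin 4))).card = 24 := by
  have hinj : Function.Injective
      (fun σ : Equiv.Perm (Fin 4) => pedge (L := L) hi hj ∘ (σ : Fin 4 → Fin 4)) := by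
    intro σ τ hστ
    ext k
    exact congrArg Fin.val (pedge_injective hi hj hij hL (congrFun hστ k))
  rw [Finset.card_image_of_injective _ hinj, Finset.card_univ, Fintype.card_perm, Fintype.card_fin]
  rfl

/-- **`∫ Re tr ρ(tubeWord u e') · (Σ_ℓ Re tr ρ(u ℓ))⁴ du = 24 θ⁴ xObsG(e')`.** [folklore] -/
theorem integral_trRe_tubeWord_mul_pow_four (h : OneLink ρ θ) (hL : 2 ≤ L) (e' : LEdge d L a → G) :
    ∫ u, (trRe ρ (tubeWord hi hj u e') : ℂ) * (((∑ ℓ, trRe ρ (u ℓ) : ℝ)) : ℂ) ^ 4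
        ∂(Measure.pi fun _ : LEdge d L a => haarProbability G) = 24 * ((θ : ℂ) ^ 4 * xObsG ρ hi hj e') := by
  have hexp : ∀ u : LEdge d L a → G, (trRe ρ (tubeWord hi hj u e') : ℂ) *
      (((∑ ℓ, trRe ρ (u ℓ) : ℝ)) : ℂ) ^ 4 =
      ∑ w : Fin 4 → LEdge d L a, (trRe ρ (tubeWord hi hj u e') : ℂ) * ∏ l, (trRe ρ (u (w l)) : ℂ) := by
    intro u
    push_cast
    rw [Fintype.sum_pow, Finset.mul_sum]
  simp_rw [hexp]
  have hint : ∀ w : Fin 4 → LEdge d L a, Integrable (fun u : LEdge d L a → G =>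
      (trRe ρ (tubeWord hi hj u e') : ℂ) * ∏ l, (trRe ρ (u (w l)) : ℂ))
      (Measure.pi fun _ : LEdge d L a => haarProbability G) := by
    intro w
    have hc : Continuous fun u : LEdge d L a → G =>
        (trRe ρ (tubeWord hi hj u e') : ℂ) * ∏ l, (trRe ρ (u (w l)) : ℂ) := by
      refine (Complex.continuous_ofReal.comp ((continuous_trRe ρ h.cont).comp
        ((continuous_tubeWord hi hj).comp (continuous_id.prodMk continuous_const)))).mul ?_
      exact continuous_finsetProd _ fun l _ =>
        Complex.continuous_ofReal.comp ((continuous_trRe ρ h.cont).comp (continuous_apply _))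
    obtain ⟨M, hM⟩ := exists_norm_le_of_continuous hc
    exact Integrable.of_bound hc.measurable.aestronglyMeasurable _ (Eventually.of_forall hM)
  rw [integral_finsetSum _ fun w _ => hint w]
  simp_rw [integral_tubeWord_word hi hj hij h hL e']
  rw [Finset.sum_ite_mem, Finset.univ_inter, Finset.sum_const, card_perm_words hi hj hij hL,
    nsmul_eq_mul]
  norm_num

end Words

/-! ## 4. The eigenvalue -/

section Eigen

variable [SecondCountableTopology G] (hij : i ≠ j)
include hij

/-- **`∫ xObsG(e) K4G(e, e') de = 24 θ⁴ xObsG(e')`** (Fubini, bond substitution, the tube word).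
[folklore] -/
theorem integral_xObsG_mul_K4G (h : OneLink ρ θ) (hL : 2 ≤ L) (e' : LEdge d L a → G) :
    ∫ e, (xObsG ρ hi hj e : ℂ) * K4G ρ e e' ∂(Measure.pi fun _ : LEdge d L a => haarProbability G) =
      24 * ((θ : ℂ) ^ 4 * xObsG ρ hi hj e') := by
  have hρ := h.cont
  -- the double integrand and its integrability
  have hc : Continuous (Function.uncurry fun (e : LEdge d L a → G) (v : LSite d L a → G) =>
      (xObsG ρ hi hj e : ℂ) * ((slabCostG ρ e v e' : ℝ) : ℂ) ^ 4) :=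
    ((Complex.continuous_ofReal.comp (continuous_xObsG ρ hi hj hρ)).comp continuous_fst).mul
      ((Complex.continuous_ofReal.comp ((continuous_slabCostG ρ hρ).comp
        (continuous_fst.prodMk (continuous_snd.prodMk continuous_const)))).pow 4)
  have hint : Integrable (Function.uncurry fun (e : LEdge d L a → G) (v : LSite d L a → G) =>
      (xObsG ρ hi hj e : ℂ) * ((slabCostG ρ e v e' : ℝ) : ℂ) ^ 4)
      ((Measure.pi fun _ : LEdge d L a => haarProbability G).prod
        (Measure.pi fun _ : LSite d L a => haarProbability G)) := by
    refine Integrable.of_bound hc.measurable.aestronglyMeasurable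
      (trReBound (G := G) (ρ := ρ) hρ * (Fintype.card (LEdge d L a) * trReBound (G := G) (ρ := ρ) hρ) ^ 4)
      (Eventually.of_forall fun p => ?_)
    simp only [Function.uncurry]
    rw [norm_mul]
    refine mul_le_mul ?_ (norm_slabCostG_pow_four_le hρ p.1 p.2 e') (norm_nonneg _)
      (trReBound_nonneg hρ)
    rw [Complex.norm_real, Real.norm_eq_abs]
    exact abs_xObsG_le ρ hi hj hρ p.1
  -- `xObsG(e) K4G(e,e') = ∫ xObsG(e) slabCostG⁴ dv`
  have h1 : ∀ e : LEdge d L a → G, (xObsG ρ hi hj e : ℂ) * K4G ρ e e' =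
      ∫ v, (xObsG ρ hi hj e : ℂ) * ((slabCostG ρ e v e' : ℝ) : ℂ) ^ 4
        ∂(Measure.pi fun _ : LSite d L a => haarProbability G) := fun e => by
    rw [K4G, integral_const_mul]
  simp_rw [h1]
  rw [integral_integral_swap hint]
  -- inner integral by bond substitution
  have h2 : ∀ v : LSite d L a → G,
      ∫ e, (xObsG ρ hi hj e : ℂ) * ((slabCostG ρ e v e' : ℝ) : ℂ) ^ 4
        ∂(Measure.pi fun _ : LEdge d L a => haarProbability G) =
      ∫ u, (trRe ρ (tubeWord hi hj u e') : ℂ) * (((∑ ℓ, trRe ρ (u ℓ) : ℝ)) : ℂ) ^ 4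
        ∂(Measure.pi fun _ : LEdge d L a => haarProbability G) := by
    intro v
    have h := integral_comp_plaqG_left (fun u : LEdge d L a → G =>
      (trRe ρ (tubeWord hi hj u e') : ℂ) * (((∑ ℓ, trRe ρ (u ℓ) : ℝ)) : ℂ) ^ 4) v e'
    rw [← h]
    refine integral_congr_ae (Eventually.of_forall fun e => ?_)
    simp only [xObsG_eq_trRe_tubeWord hi hj ρ e v e', slabCostG]
  simp_rw [h2, integral_trRe_tubeWord_mul_pow_four hi hj hij h hL e']
  rw [integral_const, probReal_univ, one_smul]

/-- **THE EIGENVALUE RELATION**: `∫ xObsG(e) ρ₄(e, e') de = θ⁴ · xObsG(e')` for every compact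
gauge group with one-link data `OneLink ρ θ` (layer side `L ≥ 2`). [folklore] -/
theorem integral_xObsG_mul_rho4G (h : OneLink ρ θ) (hL : 2 ≤ L) (e' : LEdge d L a → G) :
    ∫ e, (xObsG ρ hi hj e : ℂ) * rho4G ρ e e' ∂(Measure.pi fun _ : LEdge d L a => haarProbability G) =
      (θ : ℂ) ^ 4 * xObsG ρ hi hj e' := by
  have hρ := h.cont
  have hxc : Continuous fun e : LEdge d L a → G => (xObsG ρ hi hj e : ℂ) :=
    Complex.continuous_ofReal.comp (continuous_xObsG ρ hi hj hρ)
  obtain ⟨Mx, hMx⟩ := exists_norm_le_of_continuous hxc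
  have hix : Integrable (fun e : LEdge d L a → G => (xObsG ρ hi hj e : ℂ))
      (Measure.pi fun _ : LEdge d L a => haarProbability G) :=
    Integrable.of_bound hxc.measurable.aestronglyMeasurable _ (Eventually.of_forall hMx)
  have hixK : Integrable (fun e : LEdge d L a → G => (xObsG ρ hi hj e : ℂ) * K4G ρ e e')
      (Measure.pi fun _ : LEdge d L a => haarProbability G) :=
    Integrable.of_bound (hxc.measurable.mul ((measurable_K4G hρ).comp
      (measurable_id.prodMk measurable_const))).aestronglyMeasurable (Mx *
        (Fintype.card (LEdge d L a) * trReBound (G := G) (ρ := ρ) hρ) ^ 4)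
      (Eventually.of_forall fun e => by
        rw [norm_mul]
        exact mul_le_mul (hMx e) (norm_K4G_le hρ e e') (norm_nonneg _)
          ((norm_nonneg _).trans (hMx e)))
  have hsplit : ∀ e : LEdge d L a → G, (xObsG ρ hi hj e : ℂ) * rho4G ρ e e' =
      24⁻¹ * ((xObsG ρ hi hj e : ℂ) * K4G ρ e e') - 24⁻¹ * c4G ρ d L a * (xObsG ρ hi hj e : ℂ) := by
    intro e; rw [rho4G]; ring
  simp_rw [hsplit]
  rw [integral_sub (hixK.const_mul _) (hix.const_mul _), integral_const_mul, integral_const_mul,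
    integral_xObsG_mul_K4G hi hj hij h hL e', integral_xObsG hi hj hij h hL]
  ring

end Eigen

end Summit.Ventures.LatticeQCDFlow.Theory2.GroupLayer

end
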